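import Literature.NumberTheory.EllipticCurves.GoodReductionLangLift
import Mathlib.FieldTheory.Finite.Basic
import Mathlib.Algebra.Group.Subgroup.Finite
import HarnessLib

/-!
# Lang's theorem in the quadratic layer: `H¹ = Ĥ⁰ = 0` for `Gal(k'/k)` acting on `Ẽ(k')`
# (the finite-field step of Kramer–Tunnell 1982, Lemma 6.1)

`Proofs` file (theorems only; no definitions, no named facts) in topic
`NumberTheory/EllipticCurves`, first bottom-up step of the discharge of the named fact
`Literature.NumberTheory.EllipticCurves.KramerTunnell1982.lemma61_unramifiedNormIndex`
(`KramerTunnell1982/UnramifiedNormIndex.lean`; K. Kramer, J. Tunnell, *Elliptic curves and local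
ε-factors*, Compositio Math. 46 (1982), §6, Lemma 6.1, p. 327).  The printed proof opens with

> "Let `E₀` be the connected component of the identity in the Neron minimal model for `E`. It
> follows from Lang's theorem [9] that `N : E₀(K) → E₀(F)` is surjective."

([9] = S. Lang, *Algebraic groups over finite fields*, Amer. J. Math. 78 (1956)), for `K/F` an
unramified quadratic extension of local fields.  The surjectivity (and the companion vanishing
`H¹(Gal(K/F), E₀(K)) = 0`, used implicitly in "`dim E(F)/NE(K) = dim H⁰(G, X)`") is proved in two
layers: the special fibre `Ẽ_ns` over the residue extension `k'/k`, and the kernel of reduction.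
This file does the **special fibre of an elliptic curve with good reduction**: for an elliptic
curve `Ẽ` over a finite field `k`, a quadratic extension `k'/k` and the non-trivial automorphism
`τ` of `k'/k` (necessarily the `q`-Frobenius, `q = #k`),

* `exists_map_sub_eq_of_add_map_eq_zero` — **`H¹(⟨τ⟩, Ẽ(k')) = 0`**: every `P ∈ Ẽ(k')` with
  `P + τP = O` is `τQ - Q` for some `Q ∈ Ẽ(k')`.  Proof: Lang's theorem in the tree's form
  `WeierstrassCurve.exists_map_frob_sub_eq` (`GoodReductionLangLift`: `φ - 1` is onto `Ẽ(k̄)`,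
  from `oneSubFrobeniusIsogeny` and `Isogeny.surjective`, Silverman *AEC* II.2.3) gives
  `Q₀ ∈ Ẽ(k̄)` with `φQ₀ - Q₀ = P`; then `φ²Q₀ - Q₀ = φP + P = O`, so the coordinates of `Q₀` are
  fixed by `φ²`, i.e. are roots of `X^{q²} - X`, i.e. lie in `k'` (root counting,
  `mem_range_algebraMap_of_pow_card_sq_eq`).
* `exists_add_map_eq_of_map_eq` — **`Ĥ⁰(⟨τ⟩, Ẽ(k')) = 0`: every `P ∈ Ẽ(k)` (`τP = P`) is a norm
  `Q + τQ`, `Q ∈ Ẽ(k')`** — from the previous statement by Herbrand's count for a group of order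
  two acting on the finite group `Ẽ(k')` (`AddMonoidHom.exists_add_eq_of_forall_exists_sub_eq`:
  `#ker(τ-1)·#im(τ-1) = #M = #ker(τ+1)·#im(τ+1)`, so `ker(τ+1) = im(τ-1)` forces
  `ker(τ-1) = im(τ+1)`).

Supporting (private) lemmas: a non-trivial `k`-automorphism of a quadratic extension of the
finite field `k` is `x ↦ x^q` (Mathlib `FiniteField.bijective_frobeniusAlgEquivOfAlgebraic_pow`);
`x^{q²} = x` in an extension of `k'` forces `x ∈ k'` (root counting).  Public besides the two
results above: the two Herbrand statements for an involution of a finite abelian group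
(`AddMonoidHom.exists_add_eq_of_forall_exists_sub_eq`, `…exists_sub_eq_of_forall_exists_add_eq`).

## References

* [KramerTunnell1982] K. Kramer, J. Tunnell, *Elliptic curves and local ε-factors*, Compositio
  Math. 46 (1982) 307–352, §6 Lemma 6.1 and its proof (p. 327).
* [Lang1956] S. Lang, *Algebraic groups over finite fields*, Amer. J. Math. 78 (1956) 555–563
  (cited as [9] in the source; used through the tree theorem `exists_map_frob_sub_eq`).
* [SerreLocalFields1979] J.-P. Serre, *Local Fields*, GTM 67, Ch. VIII §4 (Herbrand quotient of a
  finite module is `1`), Ch. XIII §1.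
* [SilvermanAEC2009] J. H. Silverman, *The Arithmetic of Elliptic Curves*, 2nd ed., II.2.3.

## Design

`noncomputable section`, `open scoped Classical`; one universe `u` for `k`, `k'` (the tree's Lang
theorem is universe-monomorphic).  Points over `k'` are `(E.baseChange k').toAffine.Point`, `τ`
acts by Mathlib's `WeierstrassCurve.Affine.Point.map (τ : k' →ₐ[k] k')`.  No definitions.
-/

noncomputable section

open scoped Classical
open WeierstrassCurve WeierstrassCurve.Affine Polynomial

universe u

/-! ## §1 Herbrand's lemma for an involution of a finite abelian group -/

namespace AddMonoidHom

variable {M : Type*} [AddCommGroup M] [Finite M] (τ : M →+ M)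

omit [Finite M] in
/-- For an endomorphism `f` of a finite abelian group, `#M = #ker f · #im f`. [folklore] -/
private theorem natCard_eq_card_ker_mul_card_range (f : M →+ M) :
    Nat.card M = Nat.card f.ker * Nat.card f.range := by
  rw [AddSubgroup.card_eq_card_quotient_mul_card_addSubgroup f.ker, mul_comm,
    Nat.card_congr (QuotientAddGroup.quotientKerEquivRange f).toEquiv]

/-- **Herbrand's lemma for a group of order two, first form.**  Let `τ` be an involution of a finite
abelian group `M` (`τ² = 1`).  If every `m` with `m + τm = 0` is of the form `τn - n`
(`Ĥ⁻¹(⟨τ⟩, M) = 0`), then every `τ`-fixed `m` is a norm `n + τn` (`Ĥ⁰(⟨τ⟩, M) = 0`).  (The Herbrand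
quotient of a finite module is `1`: `#ker(τ-1)·#im(τ-1) = #M = #ker(τ+1)·#im(τ+1)`.)  Serre,
*Local Fields*, VIII §4, Prop. 8. [cite: SerreLocalFields1979, Ch. VIII §4 Prop. 8] -/
theorem exists_add_eq_of_forall_exists_sub_eq (hτ : ∀ m, τ (τ m) = m)
    (h : ∀ m : M, m + τ m = 0 → ∃ n : M, τ n - n = m) {m : M} (hm : τ m = m) :
    ∃ n : M, n + τ n = m := by
  set f : M →+ M := τ - AddMonoidHom.id M with hf
  set g : M →+ M := τ + AddMonoidHom.id M with hg
  have hf_apply : ∀ x, f x = τ x - x := fun x => rfl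
  have hg_apply : ∀ x, g x = τ x + x := fun x => rfl
  -- `im f ≤ ker g`, `im g ≤ ker f`
  have h1 : f.range ≤ g.ker := by
    rintro _ ⟨x, rfl⟩
    rw [AddMonoidHom.mem_ker, hg_apply, hf_apply, map_sub, hτ]
    abel
  have h2 : g.range ≤ f.ker := by
    rintro _ ⟨x, rfl⟩
    rw [AddMonoidHom.mem_ker, hf_apply, hg_apply, map_add, hτ]
    abel
  -- hypothesis: `ker g = im f`
  have h3 : g.ker = f.range := by
    refine le_antisymm ?_ h1
    intro x hx
    rw [AddMonoidHom.mem_ker, hg_apply, add_comm] at hx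
    obtain ⟨n, hn⟩ := h x hx
    exact ⟨n, hn⟩
  -- counting
  have hcf := natCard_eq_card_ker_mul_card_range f
  have hcg := natCard_eq_card_ker_mul_card_range g
  rw [h3] at hcg
  have hpos : 0 < Nat.card f.range := Nat.card_pos
  have h4 : Nat.card f.ker = Nat.card g.range := by
    have := hcf.symm.trans hcg
    rw [mul_comm (Nat.card f.range)] at this
    exact Nat.eq_of_mul_eq_mul_right hpos this
  have h5 : g.range = f.ker := AddSubgroup.eq_of_le_of_card_ge h2 h4.le
  have hm' : m ∈ f.ker := by rw [AddMonoidHom.mem_ker, hf_apply, hm, sub_self]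
  rw [← h5] at hm'
  obtain ⟨n, hn⟩ := hm'
  exact ⟨n, by rw [← hn, hg_apply, add_comm]⟩

/-- **Herbrand's lemma for a group of order two, second form** (the symmetric statement): if every
`τ`-fixed `m` is a norm `n + τn` (`Ĥ⁰ = 0`), then every `m` with `m + τm = 0` is `τn - n`
(`Ĥ⁻¹ = 0`).  [cite: SerreLocalFields1979, Ch. VIII §4 Prop. 8] -/
theorem exists_sub_eq_of_forall_exists_add_eq (hτ : ∀ m, τ (τ m) = m)
    (h : ∀ m : M, τ m = m → ∃ n : M, n + τ n = m) {m : M} (hm : m + τ m = 0) :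
    ∃ n : M, τ n - n = m := by
  -- apply the first form to the involution `-τ`
  have hτ' : ∀ x, (-τ) ((-τ) x) = x := fun x => by
    rw [AddMonoidHom.neg_apply, AddMonoidHom.neg_apply, map_neg, neg_neg, hτ]
  have h' : ∀ x : M, x + (-τ) x = 0 → ∃ n : M, (-τ) n - n = x := by
    intro x hx
    rw [AddMonoidHom.neg_apply, ← sub_eq_add_neg, sub_eq_zero] at hx
    obtain ⟨n, hn⟩ := h x hx.symm
    exact ⟨-n, by rw [AddMonoidHom.neg_apply, map_neg, neg_neg, sub_neg_eq_add, add_comm, hn]⟩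
  have hm' : (-τ) m = m := by
    rw [AddMonoidHom.neg_apply, neg_eq_iff_eq_neg]
    exact eq_neg_of_add_eq_zero_right hm
  obtain ⟨n, hn⟩ := exists_add_eq_of_forall_exists_sub_eq (-τ) hτ' h' hm'
  exact ⟨-n, by rw [map_neg, sub_neg_eq_add, ← hn, AddMonoidHom.neg_apply, add_comm]⟩

end AddMonoidHom

namespace Literature.NumberTheory.EllipticCurves.KramerTunnell1982

/-! ## §2 The quadratic extension of a finite field: `τ = (x ↦ x^q)` and descent from `k̄` -/

section FiniteField

variable {k : Type u} [Field k] [Finite k] {k' : Type u} [Field k'] [Algebra k k'] [Finite k']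

/-- **A non-trivial `k`-automorphism of the quadratic extension `k'` of the finite field `k` is
the `q`-Frobenius `x ↦ x^q`, `q = #k`** (`Gal(k'/k)` is cyclic of order `[k' : k] = 2` generated by
the Frobenius; Mathlib `FiniteField.bijective_frobeniusAlgEquivOfAlgebraic_pow`). [folklore] -/
private theorem algEquiv_apply_eq_pow_card (h2 : Module.finrank k k' = 2) (τ : k' ≃ₐ[k] k') (hτ : τ ≠ 1)
    (x : k') : τ x = x ^ Nat.card k := by
  letI := Fintype.ofFinite k
  obtain ⟨⟨i, hi⟩, h⟩ := (FiniteField.bijective_frobeniusAlgEquivOfAlgebraic_pow k k').2 τ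
  dsimp only at h
  rw [h2] at hi
  interval_cases i
  · rw [pow_zero] at h
    exact absurd h.symm hτ
  · rw [pow_one] at h
    rw [← h, FiniteField.coe_frobeniusAlgEquivOfAlgebraic, Nat.card_eq_fintype_card]

omit [Finite k] [Finite k'] in
/-- `#k' = q²` for the quadratic extension `k'` of the finite field `k` with `q` elements.
[folklore] -/
private theorem card_eq_card_sq (h2 : Module.finrank k k' = 2) [Fintype k] [Fintype k'] :
    Fintype.card k' = Fintype.card k ^ 2 := by
  rw [Module.card_eq_pow_finrank (K := k) (V := k'), h2]

/-- A non-trivial automorphism of the quadratic extension `k'/k` of finite fields is an involution: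
`τ(τ x) = x^{q²} = x`. [folklore] -/
private theorem algEquiv_algEquiv_apply (h2 : Module.finrank k k' = 2) (τ : k' ≃ₐ[k] k') (hτ : τ ≠ 1)
    (x : k') : τ (τ x) = x := by
  letI := Fintype.ofFinite k
  letI := Fintype.ofFinite k'
  rw [algEquiv_apply_eq_pow_card h2 τ hτ, algEquiv_apply_eq_pow_card h2 τ hτ, ← pow_mul, ← sq,
    Nat.card_eq_fintype_card, ← card_eq_card_sq h2, FiniteField.pow_card]

/-- **Descent from an extension by root counting**: in any field `L ⊇ k'`, an element with
`x^{q²} = x` (`q = #k`, `[k' : k] = 2`, so `q² = #k'`) lies in `k'` — the `q²` elements of `k'`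
exhaust the roots of `X^{q²} - X`. [folklore] -/
private theorem mem_range_algebraMap_of_pow_card_sq_eq (h2 : Module.finrank k k' = 2)
    {L : Type*} [Field L] [Algebra k' L] {x : L} (hx : x ^ (Nat.card k ^ 2) = x) :
    x ∈ (algebraMap k' L).range := by
  letI := Fintype.ofFinite k
  letI := Fintype.ofFinite k'
  have hcard : Nat.card k ^ 2 = Fintype.card k' := by
    rw [Nat.card_eq_fintype_card, card_eq_card_sq h2]
  rw [hcard] at hx
  have hq : 1 < Fintype.card k' := Fintype.one_lt_card
  set T : Finset L := (X ^ Fintype.card k' - X : L[X]).roots.toFinset with hT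
  set I : Finset L := Finset.univ.image (algebraMap k' L) with hI
  have hIT : I ⊆ T := by
    intro y hy
    obtain ⟨a, -, rfl⟩ := Finset.mem_image.mp hy
    rw [hT, Multiset.mem_toFinset, mem_roots (FiniteField.X_pow_card_sub_X_ne_zero L hq),
      IsRoot, eval_sub, eval_pow, eval_X, ← map_pow, FiniteField.pow_card, sub_self]
  have hTcard : T.card ≤ Fintype.card k' := by
    calc T.card ≤ Multiset.card (X ^ Fintype.card k' - X : L[X]).roots :=
          Multiset.toFinset_card_le _
      _ ≤ (X ^ Fintype.card k' - X : L[X]).natDegree := card_roots' _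
      _ = Fintype.card k' := FiniteField.X_pow_card_sub_X_natDegree_eq L hq
  have hIcard : I.card = Fintype.card k' := by
    rw [hI, Finset.card_image_of_injective _ (algebraMap k' L).injective, Finset.card_univ]
  have hIT' : I = T := Finset.eq_of_subset_of_card_le hIT (hTcard.trans hIcard.ge)
  have hxT : x ∈ T := by
    rw [hT, Multiset.mem_toFinset, mem_roots (FiniteField.X_pow_card_sub_X_ne_zero L hq),
      IsRoot, eval_sub, eval_pow, eval_X, hx, sub_self]
  rw [← hIT'] at hxT
  obtain ⟨a, -, ha⟩ := Finset.mem_image.mp hxT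
  exact ⟨a, ha⟩

end FiniteField

/-! ## §3 Lang's theorem in the quadratic layer: `H¹(⟨τ⟩, Ẽ(k')) = 0` -/

section Lang

variable {k : Type u} [Field k] [Finite k] {k' : Type u} [Field k'] [Algebra k k'] [Finite k']
  (E : WeierstrassCurve k) [E.IsElliptic]

omit [E.IsElliptic] in
/-- **Points fixed by `φ²` descend to `k'`**: for a field `L ⊇ k' ⊇ k` and a `k`-automorphism
`Fq` of `L` acting by `x ↦ x^q` (`q = #k`, `[k' : k] = 2`), a point `R₀ ∈ E(L)` with
`Fq (Fq R₀) = R₀` has coordinates with `x^{q²} = x`, hence in `k'`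
(`mem_range_algebraMap_of_pow_card_sq_eq`): `R₀` is the image of a point of `E(k')`. [folklore] -/
private theorem exists_map_eq_of_map_map_eq (h2 : Module.finrank k k' = 2)
    {L : Type u} [Field L] [Algebra k L] [Algebra k' L] [IsScalarTower k k' L]
    (Fq : L ≃ₐ[k] L) (hFq : ∀ x, Fq x = x ^ Nat.card k)
    {R₀ : (E.baseChange L).toAffine.Point}
    (hR₀ : Point.map (Fq : L →ₐ[k] L) (Point.map (Fq : L →ₐ[k] L) R₀) = R₀) :
    ∃ R : (E.baseChange k').toAffine.Point,
      Point.map (IsScalarTower.toAlgHom k k' L) R = R₀ := by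
  have hFq2 : ∀ x : L, Fq (Fq x) = x ^ (Nat.card k ^ 2) := fun x => by
    rw [hFq, hFq, ← pow_mul, ← sq]
  rcases R₀ with _ | ⟨x₀, y₀, h₀⟩
  · exact ⟨0, rfl⟩
  · rw [Point.map_some, Point.map_some] at hR₀
    obtain ⟨hx, hy⟩ := Point.some.inj hR₀
    change Fq (Fq x₀) = x₀ at hx
    change Fq (Fq y₀) = y₀ at hy
    rw [hFq2] at hx hy
    obtain ⟨x, rfl⟩ := mem_range_algebraMap_of_pow_card_sq_eq h2 hx
    obtain ⟨y, rfl⟩ := mem_range_algebraMap_of_pow_card_sq_eq h2 hy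
    have h' : (E.baseChange k').toAffine.Nonsingular x y :=
      (Affine.baseChange_nonsingular (W := E.toAffine)
        (IsScalarTower.toAlgHom k k' L).injective x y).mp h₀
    exact ⟨Point.some _ _ h', rfl⟩

/-- **`H¹(⟨τ⟩, Ẽ(k')) = 0` (Lang's theorem in the quadratic layer).**  For an elliptic curve `Ẽ`
over a finite field `k`, a quadratic extension `k'/k` and `τ ≠ 1` in `Aut(k'/k)`: every
`P ∈ Ẽ(k')` with `P + τP = O` is `τQ - Q` for some `Q ∈ Ẽ(k')`.  Proof: by Lang's theorem
(`WeierstrassCurve.exists_map_frob_sub_eq`) `P = φQ₀ - Q₀` with `Q₀ ∈ Ẽ(k̄)`, `φ` the `q`-Frobenius;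
then `φ²Q₀ - Q₀ = φP + P = O`, so `Q₀ ∈ Ẽ(k')`.  This is the special-fibre half of "It follows from
Lang's theorem [9] that `N : E₀(K) → E₀(F)` is surjective" in the proof of Kramer–Tunnell's
Lemma 6.1 (with Herbrand, §1). [cite: KramerTunnell1982, §6 proof of Lemma 6.1 (p. 327), "Lang's theorem [9]"] -/
theorem exists_map_sub_eq_of_add_map_eq_zero (h2 : Module.finrank k k' = 2)
    (τ : k' ≃ₐ[k] k') (hτ : τ ≠ 1) {P : (E.baseChange k').toAffine.Point}
    (hP : P + Point.map (τ : k' →ₐ[k] k') P = 0) :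
    ∃ Q : (E.baseChange k').toAffine.Point, Point.map (τ : k' →ₐ[k] k') Q - Q = P := by
  letI := Fintype.ofFinite k
  -- the algebraic closure `L` of `k'`, an algebraic closure of `k`
  let L : Type u := AlgebraicClosure k'
  haveI : Algebra.IsAlgebraic k L := Algebra.IsAlgebraic.trans k k' L
  haveI : IsAlgClosure k L := ⟨inferInstance, inferInstance⟩
  let Fq : L ≃ₐ[k] L := FiniteField.frobeniusAlgEquivOfAlgebraic k L
  have hFq : ∀ x, Fq x = x ^ Nat.card k := fun x => by
    change FiniteField.frobeniusAlgEquivOfAlgebraic k L x = _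
    rw [FiniteField.coe_frobeniusAlgEquivOfAlgebraic, Nat.card_eq_fintype_card]
  let j : k' →ₐ[k] L := IsScalarTower.toAlgHom k k' L
  -- `Fq ∘ j = j ∘ τ`
  have hcomm : (Fq : L →ₐ[k] L).comp j = j.comp (τ : k' →ₐ[k] k') := by
    ext y
    change Fq (j y) = j (τ y)
    rw [hFq, algEquiv_apply_eq_pow_card h2 τ hτ, map_pow]
  have hmap : ∀ R : (E.baseChange k').toAffine.Point,
      Point.map (Fq : L →ₐ[k] L) (Point.map j R) = Point.map j (Point.map (τ : k' →ₐ[k] k') R) :=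
    fun R => by rw [Point.map_map, Point.map_map, hcomm]
  -- Lang over `L`
  obtain ⟨Q₀, hQ₀⟩ := WeierstrassCurve.exists_map_frob_sub_eq E Fq hFq (Point.map j P)
  -- `Fq² Q₀ = Q₀`
  have hfix : Point.map (Fq : L →ₐ[k] L) (Point.map (Fq : L →ₐ[k] L) Q₀) = Q₀ := by
    have h1 : Point.map (Fq : L →ₐ[k] L) (Point.map (Fq : L →ₐ[k] L) Q₀) -
        Point.map (Fq : L →ₐ[k] L) Q₀ = Point.map (Fq : L →ₐ[k] L) (Point.map j P) := by
      rw [← map_sub, hQ₀]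
    rw [hmap] at h1
    have h2' : Point.map j (Point.map (τ : k' →ₐ[k] k') P) = -Point.map j P := by
      rw [← map_neg]
      congr 1
      exact eq_neg_of_add_eq_zero_right hP
    rw [h2', ← hQ₀] at h1
    -- h1 : FF Q₀ - F Q₀ = -(F Q₀ - Q₀)
    have := sub_eq_iff_eq_add.mp h1
    rw [this]
    abel
  obtain ⟨Q, hQ⟩ := exists_map_eq_of_map_map_eq E h2 Fq hFq hfix
  refine ⟨Q, Point.map_injective (f := j) ?_⟩
  rw [map_sub, ← hmap, hQ, hQ₀]

/-- **`Ĥ⁰(⟨τ⟩, Ẽ(k')) = 0`: over a finite field every rational point is a norm from the quadratic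
extension.**  For `Ẽ/k` elliptic, `k'/k` quadratic with `τ ≠ 1` in `Aut(k'/k)`: every `P ∈ Ẽ(k')`
fixed by `τ` (i.e. every point of `Ẽ(k)`) is `Q + τQ` for some `Q ∈ Ẽ(k')`.  From `H¹ = 0`
(`exists_map_sub_eq_of_add_map_eq_zero`) by Herbrand's lemma for the finite group `Ẽ(k')`.  This is
the special-fibre layer of the norm surjectivity `N : E₀(K) → E₀(F)` of Kramer–Tunnell's proof of
Lemma 6.1 (good reduction). [cite: KramerTunnell1982, §6 proof of Lemma 6.1 (p. 327), "N : E₀(K) → E₀(F) is surjective"] -/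
theorem exists_add_map_eq_of_map_eq (h2 : Module.finrank k k' = 2)
    (τ : k' ≃ₐ[k] k') (hτ : τ ≠ 1) {P : (E.baseChange k').toAffine.Point}
    (hP : Point.map (τ : k' →ₐ[k] k') P = P) :
    ∃ Q : (E.baseChange k').toAffine.Point, Q + Point.map (τ : k' →ₐ[k] k') Q = P := by
  letI := Fintype.ofFinite k'
  -- `Ẽ(k')` is finite
  haveI : Finite (E.baseChange k').toAffine.Point := by
    have e : (E.baseChange k').toAffine.Point ≃
        Option {xy : k' × k' // (E.baseChange k').toAffine.Nonsingular xy.1 xy.2} :=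
      Affine.nonsingularPointEquiv (E.baseChange k').toAffine
    exact Finite.of_equiv _ e.symm
  have hτ2 : ∀ R : (E.baseChange k').toAffine.Point,
      Point.map (τ : k' →ₐ[k] k') (Point.map (τ : k' →ₐ[k] k') R) = R := by
    intro R
    have hcomp : (τ : k' →ₐ[k] k').comp (τ : k' →ₐ[k] k') = AlgHom.id k k' := by
      ext y
      change τ (τ y) = y
      exact algEquiv_algEquiv_apply h2 τ hτ y
    rw [Point.map_map, hcomp]
    cases R <;> rfl
  let τ' : (E.baseChange k').toAffine.Point →+ (E.baseChange k').toAffine.Point :=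
    Point.map (τ : k' →ₐ[k] k')
  obtain ⟨Q, hQ⟩ := AddMonoidHom.exists_add_eq_of_forall_exists_sub_eq τ' hτ2
    (fun m hm => exists_map_sub_eq_of_add_map_eq_zero E h2 τ hτ hm) hP
  exact ⟨Q, hQ⟩

end Lang

end Literature.NumberTheory.EllipticCurves.KramerTunnell1982

end
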